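import Summits.QuantumFields.YangMills.Theorems.BalabanLadderUVNonSUNRecEmlAverage
import Summits.QuantumFields.YangMills.Theorems.BalabanLadderUVNonSUNRecHaarLocalDiffeo
import Literature.MathematicalPhysics.QuantumFieldTheory.Balaban1983to89.BlockAveragingEMLHaarAC
import Literature.MathematicalPhysics.QuantumFieldTheory.Balaban1983to89.T4EMLTangentInjective
import Literature.MathematicalPhysics.QuantumFieldTheory.Balaban1983to89.B16ZLowerCompactGroup
import HarnessLib

/-!
# `HaarAC` of Bałaban's block averaging (0.4) for EVERY compact `(G, r)` — the exp-mean-log fibre law through Lemma A on `r(G) ≤ U(N)`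

Support module for the residual `UVNonSUNRec` of `Summit.QuantumFields.YangMills.Theses.BalabanLadder` (item stmt-QuantumFields-19356
`UVOtherGroups`, owner's R85 item 2; `--supports stmt-QuantumFields-19356`): KERNEL PROPERTY #2 of the `(G, r)`-averaging prescription.
Written by planner ym-novel-YangMills-othergroups g5 (candidate 3cbf0470a57448b3, Part II; `LAND-REQUEST-HaarAC-Federbush.md`), landed by
prover ym-osasm-p2 g6; Part I (Lemma A on a closed subgroup of `U(N)`, any Haar measure; namespace `…Theorems.UVNonSUNRecHaarClosedSubgroup`) is the pair
`…UVNonSUNRecHaarChart` ∕ `…UVNonSUNRecHaarLocalDiffeo` (split at the 400-line rule).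

* §4 the EXP-MEAN-LOG FIBRE LAW ON A CLOSED SUBGROUP `G ≤ U(N)`: Lemma A applied to the ambient map `M ↦ exp(Σ_i c_i log(h_i M*))·M`,
  derivative chosen pointwise from `T4EMLTangentInjective.emlTangentLaw_unitary` (all skew tangent vectors, any unitary data) —
  verbatim the `SU(N)` glue `BlockAveragingEMLFibreLawSUN.emlFibreLaw_of_tangentLaw` with `SU(N) ↦ G`;
* §5 transport to an ABSTRACT compact group `G` with a faithful unitary lattice representation `r` (`G ≃* r(G) ≤ U(N)`, a continuous
  bijection of a compact onto a Hausdorff space, Haar measure pushed forward): `emlFibreLaw_rep`;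
* §6 the W-coordinate normal form of (0.4) for ANY small-loop average `ℰ` whose image under `r` is the printed `exp[mean log]` on its
  guard (`BlockAveragingEMLHaarAC` §2 with `↑· ↦ r.ρ ·`), whence the guarded fibre laws are absolutely continuous and `HaarAC (avgFun ℰ)`
  on every torus in the standing range (`BlockAveragingEMLHaarAC.haarAC_avgFun_of_guard`, G-generic), and block-averaged finite-`ε` data
  exist (`T4FiniteEpsInhabited.exists_isBlockAveraged_of_haarAC`);
* §7 the canonical structures of the route (`GaugeGroup.ofUnitaryRep`, Borel σ-algebra, `HaarData.ofCompactGroup`): the NAMED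
  `emlLoopAverage r hN` of the landed `BalabanLadderUVNonSUNRecEmlAverage` and `hasEmlAverage_haarAC r hN` — KERNEL PROPERTY #2 for every
  compact `G` and every faithful unitary `r` (no `SU(N)` hypothesis).

HONEST SCOPE.  Pure measure theory on compact matrix groups; nothing printed in [Balaban1987RG1] is asserted beyond the operation (0.4)
itself.  §7 is CARRIER-LEVEL: the finite-`ε` data it inhabits are the STUB data of `T4FiniteEpsInhabited` (at which the pinned end statement
(B) fails, `not_endStatementBPrinted_of_stubData`); it discharges the «datum block-averaged by the eml-average» clause of the line's
`ApexRep` for every `(G, r)`, never (B) ∧ (0.1) ∧ N25.  Residual leg of a CONDITIONAL chain; not a gap, not Clay.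
-/

namespace Summit.QuantumFields.YangMills.Theorems.UVNonSUNRec

open Literature.MathematicalPhysics.QuantumFieldTheory
open Literature.MathematicalPhysics.QuantumFieldTheory.Balaban1983to89
open MatrixLog ExpMeanLog BlockAveraging BlockAveragingHaarAC BlockAveragingEMLHaarAC T4Continuum AveragingRT
open scoped Matrix Matrix.Norms.L2Operator
open NormedSpace MeasureTheory Set

/-! ## §4 The exp-mean-log fibre law on a closed subgroup `G ≤ U(N)` -/

section FibreLawSubgroup

variable {N : ℕ} [NeZero N]

/-- **THE EXP-MEAN-LOG FIBRE LAW ON A CLOSED SUBGROUP `G ≤ U(N)`, ANY HAAR MEASURE.**  For every finite index type `ι`,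
every open `S ⊆ G`, family `h : ι → G`, weights `c_i ≥ 0` of total `< 1`, and measurable `K : G → G` with `‖h_i W* − 1‖ < 1/2`
on `S` and `K W = exp(Σ_i c_i log(h_i W*))·W` on `S` (series logarithm): `((μ)|_S).map K ≪ μ`.  Lemma A (§3) for the ambient map
`M ↦ exp(Σ_i c_i log(h_i M*))·M` with the derivative CHOSEN pointwise on `S` from `T4EMLTangentInjective.emlTangentLaw_unitary`
(injective on all skew tangent vectors `W·X`). [folklore] -/
theorem emlFibreLaw_closedSubgroup (Gs : Subgroup (Matrix.unitaryGroup (Fin N) ℂ))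
    (hG : IsClosed (Gs : Set (Matrix.unitaryGroup (Fin N) ℂ))) (μ : Measure Gs) [μ.IsHaarMeasure]
    {ι : Type} [Fintype ι] {S : Set Gs} (hS : IsOpen S) (h : ι → Gs) (c : ι → ℝ) (hc0 : ∀ i, 0 ≤ c i)
    (hc1 : ∑ i, c i < 1) {K : Gs → Gs} (hK : Measurable K)
    (hg : ∀ W ∈ S, ∀ i, ‖(((h i : Gs) : Matrix.unitaryGroup (Fin N) ℂ) : Matrix (Fin N) (Fin N) ℂ) *
      star (((W : Gs) : Matrix.unitaryGroup (Fin N) ℂ) : Matrix (Fin N) (Fin N) ℂ) - 1‖ < 1 / 2)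
    (hKW : ∀ W ∈ S, (((K W : Gs) : Matrix.unitaryGroup (Fin N) ℂ) : Matrix (Fin N) (Fin N) ℂ) =
      exp (∑ i, (c i : ℂ) • mlog ((((h i : Gs) : Matrix.unitaryGroup (Fin N) ℂ) : Matrix (Fin N) (Fin N) ℂ) *
        star (((W : Gs) : Matrix.unitaryGroup (Fin N) ℂ) : Matrix (Fin N) (Fin N) ℂ))) *
        (((W : Gs) : Matrix.unitaryGroup (Fin N) ℂ) : Matrix (Fin N) (Fin N) ℂ)) :
    (μ.restrict S).map K ≪ μ := by
  classical
  have hex : ∀ W ∈ S, ∃ D : Matrix (Fin N) (Fin N) ℂ →L[ℝ] Matrix (Fin N) (Fin N) ℂ,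
      HasStrictFDerivAt
          (fun M : Matrix (Fin N) (Fin N) ℂ =>
            exp (∑ i, (c i : ℂ) • mlog ((((h i : Gs) : Matrix.unitaryGroup (Fin N) ℂ) : Matrix (Fin N) (Fin N) ℂ) * star M)) * M)
          D (((W : Gs) : Matrix.unitaryGroup (Fin N) ℂ) : Matrix (Fin N) (Fin N) ℂ) ∧
        ∀ X : Matrix (Fin N) (Fin N) ℂ, Xᴴ = -X →
          D ((((W : Gs) : Matrix.unitaryGroup (Fin N) ℂ) : Matrix (Fin N) (Fin N) ℂ) * X) = 0 → X = 0 :=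
    fun W hW => T4EMLTangentInjective.emlTangentLaw_unitary (fun i => ((h i : Gs) : Matrix.unitaryGroup (Fin N) ℂ)) c hc0 hc1
      ((W : Gs) : Matrix.unitaryGroup (Fin N) ℂ) (hg W hW)
  let D : Gs → Matrix (Fin N) (Fin N) ℂ →L[ℝ] Matrix (Fin N) (Fin N) ℂ := fun W => if hW : W ∈ S then (hex W hW).choose else 0
  have hD : ∀ W (hW : W ∈ S), D W = (hex W hW).choose := fun W hW => dif_pos hW
  exact UVNonSUNRecHaarClosedSubgroup.haar_restrict_map_absolutelyContinuous_of_skew Gs hG μ hS hK (D := D)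
    (Kmat := fun M : Matrix (Fin N) (Fin N) ℂ =>
      exp (∑ i, (c i : ℂ) • mlog ((((h i : Gs) : Matrix.unitaryGroup (Fin N) ℂ) : Matrix (Fin N) (Fin N) ℂ) * star M)) * M)
    (fun W hW => by rw [hD W hW]; exact (hex W hW).choose_spec.1)
    (fun W hW => (hKW W hW).symm)
    (fun W hW X hX h0 => (hex W hW).choose_spec.2 X hX (by rwa [hD W hW] at h0))

end FibreLawSubgroup

/-! ## §5 Transport to an abstract compact group with a faithful unitary lattice representation -/

section FibreLawRep

variable {G : Type} [Group G] [TopologicalSpace G] [IsTopologicalGroup G] [CompactSpace G]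
  [MeasurableSpace G] [BorelSpace G]

/-- The unitary corestriction `ρᵤ : G →* U(N)` of `r`. [folklore] -/
def rhoU (r : LatticeRep G) : G →* Matrix.unitaryGroup (Fin r.N) ℂ :=
  r.ρ.codRestrict (Matrix.unitaryGroup (Fin r.N) ℂ) r.mem_unitary

omit [IsTopologicalGroup G] [CompactSpace G] [MeasurableSpace G] [BorelSpace G] in
/-- `↑(ρᵤ g) = r g`. [folklore] -/
@[simp] theorem coe_rhoU (r : LatticeRep G) (g : G) : ((rhoU r g : Matrix.unitaryGroup (Fin r.N) ℂ) : Matrix (Fin r.N) (Fin r.N) ℂ) = r.ρ g :=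
  rfl

omit [IsTopologicalGroup G] [CompactSpace G] [MeasurableSpace G] [BorelSpace G] in
/-- `ρᵤ` is continuous. [folklore] -/
theorem continuous_rhoU (r : LatticeRep G) : Continuous (rhoU r) :=
  continuous_induced_rng.2 r.continuous

omit [IsTopologicalGroup G] [CompactSpace G] [MeasurableSpace G] [BorelSpace G] in
/-- `ρᵤ` is injective (faithfulness). [folklore] -/
theorem rhoU_injective (r : LatticeRep G) : Function.Injective (rhoU r) := fun a b hab =>
  r.injective (by simpa using congrArg (fun U : Matrix.unitaryGroup (Fin r.N) ℂ => (U : Matrix (Fin r.N) (Fin r.N) ℂ)) hab)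

/-- **THE EXP-MEAN-LOG FIBRE LAW FOR `(G, r)`, ANY HAAR MEASURE ON `G`.**  `G` a compact group with a faithful continuous
unitary representation `r : G → U(N)`, `N ≥ 1`, `μ` a Haar measure on `G` (Borel): for `S ⊆ G` open, `h : ι → G`, weights
`c_i ≥ 0` of total `< 1` and `K : G → G` measurable with `‖r(h_i) r(W)* − 1‖ < 1/2` and
`r(K W) = exp(Σ_i c_i log(r(h_i) r(W)*))·r(W)` on `S`: `((μ)|_S).map K ≪ μ`.  Transport of §4 along the topological group
isomorphism `G ≃ r(G) ≤ U(N)` (continuous bijection of a compact onto a Hausdorff space; Haar goes to Haar). [folklore] -/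
theorem emlFibreLaw_rep (r : LatticeRep G) (hN : 0 < r.N) (μ : Measure G) [μ.IsHaarMeasure]
    {ι : Type} [Fintype ι] {S : Set G} (hS : IsOpen S) (h : ι → G) (c : ι → ℝ) (hc0 : ∀ i, 0 ≤ c i) (hc1 : ∑ i, c i < 1)
    {K : G → G} (hK : Measurable K)
    (hg : ∀ W ∈ S, ∀ i, ‖r.ρ (h i) * star (r.ρ W) - 1‖ < 1 / 2)
    (hKW : ∀ W ∈ S, r.ρ (K W) = exp (∑ i, (c i : ℂ) • mlog (r.ρ (h i) * star (r.ρ W))) * r.ρ W) :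
    (μ.restrict S).map K ≪ μ := by
  classical
  haveI : NeZero r.N := ⟨hN.ne'⟩
  have hfc : Continuous (rhoU r) := continuous_rhoU r
  have hfi : Function.Injective (rhoU r) := rhoU_injective r
  have hGc : IsClosed (((rhoU r).range : Subgroup (Matrix.unitaryGroup (Fin r.N) ℂ)) :
      Set (Matrix.unitaryGroup (Fin r.N) ℂ)) := by
    rw [MonoidHom.coe_range]; exact (isCompact_range hfc).isClosed
  set e : G ≃* (rhoU r).range := MonoidHom.ofInjective hfi with he_def
  have hecoe : ∀ g : G, ((((e g : (rhoU r).range) : Matrix.unitaryGroup (Fin r.N) ℂ)) : Matrix (Fin r.N) (Fin r.N) ℂ) = r.ρ g :=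
    fun g => rfl
  have he : Continuous e :=
    continuous_induced_rng.2 (show Continuous fun g : G => ((e g : (rhoU r).range) : Matrix.unitaryGroup (Fin r.N) ℂ) from hfc)
  have hes : Continuous e.symm := Continuous.continuous_symm_of_equiv_compact_to_t2 (f := e.toEquiv) he
  have hcoe' : ∀ W' : (rhoU r).range,
      (((W' : (rhoU r).range) : Matrix.unitaryGroup (Fin r.N) ℂ) : Matrix (Fin r.N) (Fin r.N) ℂ) = r.ρ (e.symm W') := fun W' => by
    rw [← hecoe (e.symm W'), MulEquiv.apply_symm_apply]
  haveI : (μ.map e).IsHaarMeasure := e.isHaarMeasure_map μ he hes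
  have hem : Measurable e := he.measurable
  have hesm : Measurable e.symm := hes.measurable
  -- the transported data on `r(G)`
  have hS' : IsOpen (e.symm ⁻¹' S) := hS.preimage hes
  have hK' : Measurable fun W' : (rhoU r).range => e (K (e.symm W')) := hem.comp (hK.comp hesm)
  have hGs : ((μ.map e).restrict (e.symm ⁻¹' S)).map (fun W' : (rhoU r).range => e (K (e.symm W'))) ≪ μ.map e :=
    emlFibreLaw_closedSubgroup (rhoU r).range hGc (μ.map e) hS' (fun i => e (h i)) c hc0 hc1 hK'
      (fun W' hW' i => by rw [hecoe, hcoe' W']; exact hg _ hW' i)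
      (fun W' hW' => by
        rw [hecoe, hcoe' W', hKW _ hW']
        exact congrArg (fun M => exp M * r.ρ (e.symm W')) (Finset.sum_congr rfl fun i _ => by rw [hecoe]))
  -- pull back along `e`
  refine Measure.AbsolutelyContinuous.mk fun T hT hT0 => ?_
  rw [Measure.map_apply hK hT, Measure.restrict_apply (hK hT)]
  have hT' : MeasurableSet (e.symm ⁻¹' T) := hesm hT
  have h0' : (μ.map e) (e.symm ⁻¹' T) = 0 := by
    rw [Measure.map_apply hem hT', ← Set.preimage_comp,
      show ((e.symm : (rhoU r).range → G) ∘ (e : G → (rhoU r).range)) = id from funext fun g => e.symm_apply_apply g,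
      Set.preimage_id]
    exact hT0
  have h1 := hGs h0'
  rw [Measure.map_apply hK' hT', Measure.restrict_apply (hK' hT'), Measure.map_apply hem ((hK' hT').inter hS'.measurableSet)] at h1
  have hset : (e : G → (rhoU r).range) ⁻¹' ((fun W' : (rhoU r).range => e (K (e.symm W'))) ⁻¹' (e.symm ⁻¹' T) ∩ e.symm ⁻¹' S) =
      K ⁻¹' T ∩ S := by
    ext g
    simp only [Set.mem_preimage, Set.mem_inter_iff, MulEquiv.symm_apply_apply]
  rwa [hset] at h1

end FibreLawRep

/-! ## §6 The W-coordinate normal form of (0.4) for a small-loop average read through `r`, and `HaarAC` -/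

section RepNormalForm

variable {P : Params} {j : ℕ} {G : Type} [GaugeGroup G] [TopologicalSpace G] (r : LatticeRep G)
  (hdist : ∀ g : G, dist1 g = ‖r.ρ g - 1‖) (ℰ : LoopAverage G)
  (heml : ∀ (m : ℕ) (W : Fin (m + 1) → G), (∀ i, dist1 (W i) < ℰ.δ) →
    r.ρ (ℰ.E W) = ExpMeanLog.eml (fun i => r.ρ (W i)))

/-- A unitary representation maps inverses to adjoints (private copy; the public statement is `UVNonSUNRec.rho_inv_star` of
`…UVNonSUNRecFederbush`, not imported here). [folklore] -/
private theorem rho_inv_eq_star (g : G) : r.ρ g⁻¹ = star (r.ρ g) := by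
  have h1 : r.ρ g⁻¹ * r.ρ g = 1 := by rw [← map_mul, inv_mul_cancel, map_one]
  have h2 : r.ρ g * star (r.ρ g) = 1 := Matrix.mem_unitaryGroup_iff.1 (r.mem_unitary g)
  calc r.ρ g⁻¹ = r.ρ g⁻¹ * (r.ρ g * star (r.ρ g)) := by rw [h2, mul_one]
    _ = star (r.ρ g) := by rw [← mul_assoc, h1, one_mul]

include heml in
/-- **UNDER `r`, ON THE GUARD THE AVERAGE IS THE PRINTED EXPONENTIAL**: for `W : ι → G` with `dist1 W_i < δ`,
`r(ℰ.avg W) = exp(|ι|⁻¹ Σ_i log r(W_i))` (the fixed enumeration of `LoopAverage.avg` is immaterial).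
[cite: Balaban1987RG1, (0.4) p.253] -/
theorem rho_avg_eq {ι : Type*} [Fintype ι] [Nonempty ι] (W : ι → G) (hW : ∀ i, dist1 (W i) < ℰ.δ) :
    r.ρ (ℰ.avg W) = exp (((Fintype.card ι : ℂ))⁻¹ • ∑ i, mlog (r.ρ (W i))) := by
  have h' : ∀ k, dist1 ((W ∘ (LoopAverage.enum ι).symm) k) < ℰ.δ := fun k => hW _
  show r.ρ (ℰ.E (W ∘ (LoopAverage.enum ι).symm)) = _
  rw [heml _ _ h', ← eml_eq_exp]
  exact eml_comp_equiv' (fun i => r.ρ (W i)) (LoopAverage.enum ι).symm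

/-- Under `r`, the off-central W-coordinate variable is `r(V_i) r(W)*`. [folklore] -/
theorem rho_fibreFamily_of_not_isCentral (U : GaugeField P j G) (c : PBond P (j+1)) (W : G) (i : Idx P)
    (h : ¬ IsCentral c i) : r.ρ (fibreFamily U c W i) = r.ρ (openHol U c i) * star (r.ρ W) := by
  rw [fibreFamily_of_not_isCentral U c W i h, map_mul, rho_inv_eq_star]

include hdist in
/-- `dist1 (V_i W⁻¹) = ‖r(V_i) r(W)* − 1‖` at an off-central index. [folklore] -/
theorem dist1_fibreFamily_of_not_isCentral_rep (U : GaugeField P j G) (c : PBond P (j+1)) (W : G) (i : Idx P)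
    (h : ¬ IsCentral c i) : dist1 (fibreFamily U c W i) = ‖r.ρ (openHol U c i) * star (r.ρ W) - 1‖ := by
  rw [hdist, rho_fibreFamily_of_not_isCentral r U c W i h]

include hdist in
/-- **THE W-COORDINATE GUARD IS OPEN** (continuity of `r`). [folklore] -/
theorem isOpen_fibreGuard_rep (U : GaugeField P j G) (c : PBond P (j+1)) : IsOpen (fibreGuard ℰ U c) := by
  have hδ := ℰ.δ_pos
  have hset : fibreGuard ℰ U c = ⋂ i, {W : G | dist1 (fibreFamily U c W i) < ℰ.δ} := by
    ext W; simp [fibreGuard, FibreSmall]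
  rw [hset]
  refine isOpen_iInter_of_finite fun i => ?_
  by_cases h : IsCentral c i
  · have huniv : {W : G | dist1 (fibreFamily U c W i) < ℰ.δ} = Set.univ :=
      Set.eq_univ_of_forall fun W => by
        show dist1 (fibreFamily U c W i) < _
        rw [fibreFamily_of_isCentral U c W i h, GaugeGroup.dist1_one]; exact hδ
    rw [huniv]; exact isOpen_univ
  · have hset' : {W : G | dist1 (fibreFamily U c W i) < ℰ.δ} = {W : G | ‖r.ρ (openHol U c i) * star (r.ρ W) - 1‖ < ℰ.δ} := by
      ext W; rw [Set.mem_setOf_eq, Set.mem_setOf_eq, dist1_fibreFamily_of_not_isCentral_rep r hdist U c W i h]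
    rw [hset']
    exact isOpen_lt ((continuous_const.mul r.continuous.star).sub continuous_const).norm continuous_const

/-- The central terms drop out of the printed sum (`log r(1) = 0`). [folklore] -/
theorem sum_mlog_fibreFamily_rep (U : GaugeField P j G) (c : PBond P (j+1)) (W : G) :
    ∑ i, mlog (r.ρ (fibreFamily U c W i)) = ∑ k : Fin (offCard c), mlog (r.ρ (offHol U c k) * star (r.ρ W)) := by
  rw [← Fintype.sum_subtype_add_sum_subtype (IsCentral c) (fun i => mlog (r.ρ (fibreFamily U c W i)))]
  have h0 : ∑ x : {i : Idx P // IsCentral c i}, mlog (r.ρ (fibreFamily U c W x)) = 0 :=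
    Fintype.sum_eq_zero _ fun x => by rw [fibreFamily_of_isCentral U c W x x.2, map_one]; exact mlog_one
  rw [h0, zero_add]
  exact Fintype.sum_equiv (offEquiv c) _ _ fun x => by
    rw [rho_fibreFamily_of_not_isCentral r U c W x x.2, offHol, Equiv.symm_apply_apply]

include heml in
/-- **THE GUARDED FIBRE MAP UNDER `r`**: on the guard, `r(ℰ.avg (fibreFamily W) · W) = exp(Σ_k |I|⁻¹ log(r(h_k) r(W)*))·r(W)`.
[cite: Balaban1987RG1, (0.4) p.253] -/
theorem rho_fibreCore_eq (U : GaugeField P j G) (c : PBond P (j+1)) {W : G} (hW : W ∈ fibreGuard ℰ U c) :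
    r.ρ (ℰ.avg (fibreFamily U c W) * W) =
      exp (∑ k : Fin (offCard c), ((emlWeight P : ℝ) : ℂ) • mlog (r.ρ (offHol U c k) * star (r.ρ W))) * r.ρ W := by
  have hw : ((emlWeight P : ℝ) : ℂ) = ((Fintype.card (Idx P) : ℂ))⁻¹ := by
    rw [emlWeight, Complex.ofReal_inv, Complex.ofReal_natCast]
  have hW' : ∀ i, dist1 (fibreFamily U c W i) < ℰ.δ := hW
  rw [hw, map_mul, rho_avg_eq r ℰ heml _ hW', sum_mlog_fibreFamily_rep r U c W, Finset.smul_sum]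

include hdist in
/-- On the guard, `‖r(h_k) r(W)* − 1‖ < 1/2` for every off-central `k`, as soon as `δ ≤ 1/2`. [folklore] -/
theorem norm_offHol_mul_star_sub_one_lt_rep (hδ : ℰ.δ ≤ 1 / 2) (U : GaugeField P j G) (c : PBond P (j+1)) {W : G}
    (hW : W ∈ fibreGuard ℰ U c) (k : Fin (offCard c)) : ‖r.ρ (offHol U c k) * star (r.ρ W) - 1‖ < 1 / 2 := by
  have hW' : ∀ i, dist1 (fibreFamily U c W i) < ℰ.δ := hW
  have hi := hW' ((offEquiv c).symm k).1
  rw [dist1_fibreFamily_of_not_isCentral_rep r hdist U c W _ ((offEquiv c).symm k).2] at hi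
  exact lt_of_lt_of_le hi hδ

variable [IsTopologicalGroup G] [CompactSpace G] [MeasurableSpace G] [BorelSpace G]

omit [CompactSpace G] in
/-- On a compact group every `HaarData` measure IS a Haar measure (left-invariant probability measure, positive on opens by
compactness). [folklore] -/
theorem isHaarMeasure_haarData [CompactSpace G] [HaarData G] : (HaarData.haar : Measure G).IsHaarMeasure := by
  haveI : (HaarData.haar : Measure G).IsMulLeftInvariant := ⟨fun g => HaarData.map_mul_left g⟩
  haveI : IsProbabilityMeasure (HaarData.haar : Measure G) := HaarData.isProb
  exact Measure.isHaarMeasure_of_isCompact_nonempty_interior _ Set.univ isCompact_univ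
    (by rw [interior_univ]; exact Set.univ_nonempty) (by rw [measure_univ]; exact one_ne_zero) (measure_ne_top _ _)

include hdist heml in
/-- **THE GUARDED FIBRE LAWS OF (0.4) FOR `(G, r)` ARE ABSOLUTELY CONTINUOUS** (`δ ≤ 1/2`, `N ≥ 1`): §5 at the open guard, the
off-central open holonomies, the uniform weights `|I|⁻¹` of total `< 1`, and the normal form `rho_fibreCore_eq`. [folklore] -/
theorem haar_restrict_fibreGuard_map_absolutelyContinuous_rep [RegularGaugeGroup G] [HaarData G] (hN : 0 < r.N)
    (hδ : ℰ.δ ≤ 1 / 2) (hE : ℰ.MeasurableE) (U : GaugeField P j G) (c : PBond P (j+1)) :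
    ((HaarData.haar : Measure G).restrict (fibreGuard ℰ U c)).map (fun W => ℰ.avg (fibreFamily U c W) * W) ≪ HaarData.haar := by
  haveI := isHaarMeasure_haarData (G := G)
  exact emlFibreLaw_rep r hN HaarData.haar (isOpen_fibreGuard_rep r hdist ℰ U c) (offHol U c) (fun _ => emlWeight P)
    (fun _ => emlWeight_nonneg P) (sum_emlWeight_lt_one c) (measurable_fibreCore ℰ hE U c)
    (fun W hW k => norm_offHol_mul_star_sub_one_lt_rep r hdist ℰ hδ U c hW k) (fun W hW => rho_fibreCore_eq r ℰ heml U c hW)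

include hdist heml in
/-- **`HaarAC` OF (0.4) FOR `(G, r)`** on every torus in the standing range `j + 1 ≤ m + K`, for every measurable small-loop
average whose image under `r` is the printed `exp[mean log]` on its guard of radius `≤ 1/2`
(`BlockAveragingEMLHaarAC.haarAC_avgFun_of_guard`). [folklore] -/
theorem haarAC_avgFun_rep [RegularGaugeGroup G] [HaarData G] (hN : 0 < r.N) (hδ : ℰ.δ ≤ 1 / 2) (hE : ℰ.MeasurableE)
    (hj : j + 1 ≤ P.m + P.K) : T4FiniteEpsInhabited.HaarAC (avgFun ℰ : GaugeField P j G → GaugeField P (j+1) G) :=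
  haarAC_avgFun_of_guard hj ℰ hE fun U c => haar_restrict_fibreGuard_map_absolutelyContinuous_rep r hdist ℰ heml hN hδ hE U c

include hdist heml in
/-- `HaarAC` on every torus of a family in the standing range `k < K`. [folklore] -/
theorem haarAC_avgFun_rep_family [RegularGaugeGroup G] [HaarData G] (hN : 0 < r.N) (hδ : ℰ.δ ≤ 1 / 2) (hE : ℰ.MeasurableE)
    (F : T4Family) (K k : ℕ) (hk : k < K) :
    T4FiniteEpsInhabited.HaarAC (avgFun ℰ : GaugeField (F.P K) k G → GaugeField (F.P K) (k + 1) G) :=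
  haarAC_avgFun_rep r hdist ℰ heml hN hδ hE (by show k + 1 ≤ F.m + K; omega)

include hdist heml in
/-- Block-averaged finite-`ε` data for `(G, r)` driven by `ℰ` EXIST (the STUB inhabitant of `T4FiniteEpsInhabited`: carrier
inhabitation, not the theorem). [folklore] -/
theorem exists_isBlockAveraged_rep [RegularGaugeGroup G] [HaarData G] (hN : 0 < r.N) (hδ : ℰ.δ ≤ 1 / 2) (hE : ℰ.MeasurableE)
    (F : T4Family) : ∃ D : T4Continuum.FiniteEpsData F G, D.IsBlockAveraged ℰ :=
  T4FiniteEpsInhabited.exists_isBlockAveraged_of_haarAC F G ℰ hE fun K k hk =>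
    haarAC_avgFun_rep_family r hdist ℰ heml hN hδ hE F K k hk

end RepNormalForm

/-! ## §7 The canonical structures of the route: the eml loop average of `(G, r)` and KERNEL PROPERTY #2 -/

section Canonical

variable {G : Type} [Group G] [TopologicalSpace G] [IsTopologicalGroup G] [CompactSpace G] (r : LatticeRep G) (hN : 0 < r.N)

omit [IsTopologicalGroup G] in
/-- **THE EML LOOP AVERAGE OF `(G, r)`** as a NAMED `LoopAverage` over `GaugeGroup.ofUnitaryRep G r` — the witness of the landed
`hasEmlAverage r hN` (radius `δ_r ≤ 1/4`, `E = emlAvg r`, axioms (0.5)–(0.7) from `BalabanLadderUVNonSUNRecEmlAverage` §2).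
[cite: Balaban1987RG1, (0.4)–(0.7) p.253] -/
noncomputable def emlLoopAverage :
    haveI : Nonempty (Fin r.N) := ⟨⟨0, hN⟩⟩
    letI : GaugeGroup G := GaugeGroup.ofUnitaryRep G r.ρ r.mem_unitary
    LoopAverage G := by
  haveI : Nonempty (Fin r.N) := ⟨⟨0, hN⟩⟩
  letI : GaugeGroup G := GaugeGroup.ofUnitaryRep G r.ρ r.mem_unitary
  exact { δ := emlRadius r
          δ_pos := emlRadius_pos r
          E := fun W => emlAvg r W
          inv := fun W hW => emlAvg_inv r hW
          conj := fun W hW u => emlAvg_conj r hW u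
          perm := fun W _ σ => emlAvg_perm r W σ }

/-- **KERNEL PROPERTY #2 OF THE `(G, r)` AVERAGING PRESCRIPTION — `HaarAC` of Bałaban's block averaging (0.4) driven by the
eml-average, for EVERY compact group `G` and EVERY faithful unitary lattice representation `r` with `N ≥ 1` (no `SU(N)`
hypothesis: Spin, Sp, exceptional groups and centre quotients included), in the route's canonical structures**
(`GaugeGroup.ofUnitaryRep`, Borel σ-algebra, `HaarData.ofCompactGroup`): the eml-average `ℰ` is measurable, equals the printed
`exp[|I|⁻¹ Σ log r(W_i)]` under `r` on its guard (= `HasEmlAverage r hN`), `HaarAC (avgFun ℰ)` holds on every torus in the standing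
range, and for every four-torus lattice family `F` finite-`ε` data block-averaged by `ℰ` EXIST — the «datum block-averaged by
THAT average» clause of the skeleton's `ApexRep G r hN`, carrier level (the inhabitant is the stub of `T4FiniteEpsInhabited`, at
which (B) fails).  [cite: Balaban1987RG1, (0.4)–(0.7) p.253] -/
theorem hasEmlAverage_haarAC :
    haveI : Nonempty (Fin r.N) := ⟨⟨0, hN⟩⟩
    letI : GaugeGroup G := GaugeGroup.ofUnitaryRep G r.ρ r.mem_unitary
    letI : MeasurableSpace G := borel G
    haveI : BorelSpace G := ⟨rfl⟩
    letI : HaarData G := HaarData.ofCompactGroup G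
    ∃ ℰ : LoopAverage G,
      (ℰ.MeasurableE ∧ ∀ (m : ℕ) (W : Fin (m + 1) → G), (∀ i, dist1 (W i) < ℰ.δ) →
        r.ρ (ℰ.E W) = ExpMeanLog.eml (fun i => r.ρ (W i))) ∧
      (∀ (P : Params) (j : ℕ), j + 1 ≤ P.m + P.K →
        T4FiniteEpsInhabited.HaarAC (avgFun ℰ : GaugeField P j G → GaugeField P (j + 1) G)) ∧
      ∀ F : T4Family, ∃ D : T4Continuum.FiniteEpsData F G, D.IsBlockAveraged ℰ := by
  haveI : Nonempty (Fin r.N) := ⟨⟨0, hN⟩⟩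
  letI : GaugeGroup G := GaugeGroup.ofUnitaryRep G r.ρ r.mem_unitary
  letI : MeasurableSpace G := borel G
  haveI : BorelSpace G := ⟨rfl⟩
  letI : HaarData G := HaarData.ofCompactGroup G
  haveI : SecondCountableTopology G := by
    haveI := secondCountableTopology_matrix (n := Fin r.N)
    exact (r.continuous.isClosedEmbedding r.injective).isEmbedding.secondCountableTopology
  haveI : RegularGaugeGroup G := B16ZLowerCompactGroup.regularGaugeGroup_ofUnitaryRep r.ρ r.continuous r.mem_unitary
  have hdist : ∀ g : G, dist1 g = ‖r.ρ g - 1‖ := fun _ => rfl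
  have heml : ∀ (m : ℕ) (W : Fin (m + 1) → G), (∀ i, dist1 (W i) < (emlLoopAverage r hN).δ) →
      r.ρ ((emlLoopAverage r hN).E W) = ExpMeanLog.eml (fun i => r.ρ (W i)) := fun m W hW => rho_emlAvg_of_small r hW
  have hE : (emlLoopAverage r hN).MeasurableE := fun m => measurable_emlAvg r m
  have hδ : (emlLoopAverage r hN).δ ≤ 1 / 2 := (emlRadius_le r).trans (by norm_num)
  exact ⟨emlLoopAverage r hN, ⟨hE, heml⟩, fun P j hj => haarAC_avgFun_rep r hdist _ heml hN hδ hE hj,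
    fun F => exists_isBlockAveraged_rep r hdist _ heml hN hδ hE F⟩

/-- The same packaged for the skeleton's binder list (`∀ G …, IsCompactSimpleLieGroup G → non-SU(N) → ∀ r hN, …`; the class
hypotheses are not used). [cite: Balaban1987RG1, (0.4)–(0.7) p.253] -/
theorem hasEmlAverage_haarAC_all :
    ∀ (G : Type) [Group G] [TopologicalSpace G] [IsTopologicalGroup G] [CompactSpace G],
      IsCompactSimpleLieGroup G → (∀ N : ℕ, 2 ≤ N → IsEmpty (G ≃ₜ* Matrix.specialUnitaryGroup (Fin N) ℂ)) →
      ∀ (r : LatticeRep G) (hN : 0 < r.N),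
        haveI : Nonempty (Fin r.N) := ⟨⟨0, hN⟩⟩
        letI : GaugeGroup G := GaugeGroup.ofUnitaryRep G r.ρ r.mem_unitary
        letI : MeasurableSpace G := borel G
        haveI : BorelSpace G := ⟨rfl⟩
        letI : HaarData G := HaarData.ofCompactGroup G
        ∃ ℰ : LoopAverage G,
          (ℰ.MeasurableE ∧ ∀ (m : ℕ) (W : Fin (m + 1) → G), (∀ i, dist1 (W i) < ℰ.δ) →
            r.ρ (ℰ.E W) = ExpMeanLog.eml (fun i => r.ρ (W i))) ∧
          (∀ (P : Params) (j : ℕ), j + 1 ≤ P.m + P.K →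
            T4FiniteEpsInhabited.HaarAC (avgFun ℰ : GaugeField P j G → GaugeField P (j + 1) G)) ∧
          ∀ F : T4Family, ∃ D : T4Continuum.FiniteEpsData F G, D.IsBlockAveraged ℰ :=
  fun _ _ _ _ _ _ _ r hN => hasEmlAverage_haarAC r hN

end Canonical

end Summit.QuantumFields.YangMills.Theorems.UVNonSUNRec
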